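import Summits.NavierStokesRegularity.FunctionalMining.TopEigGapCutoffPowEstimate
import Summits.NavierStokesRegularity.FunctionalMining.TopEigGapFieldDeriv
import Summits.NavierStokesRegularity.FunctionalMining.TopEigGapCutoffSmooth
import Summits.NavierStokesRegularity.FunctionalMining.TopEigHeatCoerciveGap
import Summits.NavierStokesRegularity.FunctionalMining.StrainCZ
import Literature.Analysis.FunctionSpaces.TorusSobolevGagliardoNirenberg
import HarnessLib

/-!
# FunctionalMining — Proposition L-λ(η) below `q = 2` on the amplitude-floor class, INPUTS:
# the multiplier `M_q = λ₁^{q−2}·(λ₁P₁)` without cut-off, its gradient against the `e₁`-column of `∇S`,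
# continuity of the column density, and the velocity brick `∫‖u‖²λ₁^{q−2} ≤ K₀ m^{q−2} Φ_q^{2/q}` on `λ₁ ≥ m`

Search for candidate a priori estimates; no regularity claim. Cell `pub-nsfunc`, prove seat
(gen 28). Pointwise/static inputs for `TopEigGapCoerciveFloor` (the dictionary's (LL) programme: the
gap-class node `TopEigGapCoercivePos q η` below `q = 2`, located at the zeros of `λ₁`). Everything here is a
statement about one smooth divergence-free field on `T³`; nothing about Navier–Stokes is asserted.

* `isSmooth_powProj_entry` — on a field whose top strain eigenvalue is simple everywhere (hence positive),
  every entry of `M_q = λ₁^{q−2}·(λ₁·P₁)` is smooth, every real `q` (chart smoothness of `λ₁^{q−2}` and of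
  `λ₁P₁` at simple points, tree `TopEigGapCutoffPowDeriv` / `TopEigGapCutoffSmooth` / `TopEigSimpleGap`);
  `powProj_symm`; `sum_strain_mul_powProj` (`S:M_q = λ₁^q` where `λ₁ > 0`);
* **`sum_sq_partialDeriv_powProj_le_of_gap`** (every real `q`): at a simple point with
  `λ₂ ≤ (1−η)λ₁`, `∑ᵢⱼ(∂ₖ(M_q)ᵢⱼ)² ≤ 2((q−2)² + 2/η²)·(λ₁^{q−2})²·|S(∂ₖv)u₀|²` — product rule on
  `λ₁^{q−2}·(λ₁P₁)`, the tree bound `∑(∂ₖ(λ₁P₁))² ≤ (2/η²)|S(∂ₖv)u₀|²` (`TopEigGapFieldDeriv`) and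
  Hellmann–Feynman `(∂ₖλ₁)² ≤ |S(∂ₖv)u₀|²`; summed form `sum_sq_partialDeriv_powProj_le_topColumnSq`;
* `continuous_torusStrainMatrix_entry`, `column_sq_eq_sum_topProj`, **`continuous_topColumnSq`** — on
  everywhere-simple fields the column density `topColumnSq v = ∑ₖ|S(∂ₖv)u₀|²` is continuous (through the
  smooth projector `P₁`), so `λ₁^{q−2}·topColumnSq` is a genuine integrand;
* **`exists_integral_norm_sq_mul_topEig_rpow_le_of_floor`** (`6/5 ≤ q ≤ 2`): there is `K₀ ≥ 0` with
  `∫‖u‖²λ₁^{q−2} ≤ K₀·m^{q−2}·Φ_q(u)^{2/q}` for every smooth divergence-free zero-mean `u` with `λ₁ ≥ m > 0`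
  everywhere (`λ₁^{q−2} ≤ m^{q−2}`; Sobolev–Poincaré at `(s, r) = (q, 2)`, i.e. `1/q − 1/3 ≤ 1/2`
  (`Torus.exists_integral_rpow_le_gradient_of_hasZeroMean`), Calderón–Zygmund
  (`StrainTensor.exists_gradLs_le_strainLs`), `|S| ≤ 6λ₁`).
NOT CLAIMED: anything about `heatDissipation` (that is the sequel), any node, any constant value,
Navier–Stokes regularity. [ours]
-/

noncomputable section

open Filter Topology Matrix Finset MeasureTheory
open scoped ContDiff

namespace Summit.NavierStokesRegularity.FunctionalMining

open Literature.Analysis Literature.Analysis.FunctionSpaces Literature.Analysis.FunctionSpaces.Torus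
  SharpClass.DirectorForm Literature.Analysis.Matrix

namespace TopEig

open StrainL4 StrainTensor

variable {v : UnitAddTorus (Fin 3) → EuclideanSpace ℝ (Fin 3)}

/-! ## 1. The multiplier `M_q = λ₁^{q−2}·(λ₁P₁)` on everywhere-simple fields: smoothness, symmetry, `S:M_q = λ₁^q` -/

/-- On a divergence-free field whose top strain eigenvalue is simple everywhere, every entry of
`M_q = λ₁^{q−2}·(λ₁·P₁)` is smooth (every real `q`; `λ₁ > 0` at simple points). [ours] -/
theorem isSmooth_powProj_entry (hv : Torus.IsSmooth v) (hdiv : Torus.IsDivFree v) (q : ℝ)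
    (hsimple : ∀ x : UnitAddTorus (Fin 3), torusStrainMidEig v x < torusStrainTopEig v x) (i j : Fin 3) :
    Torus.IsSmooth (fun y => torusStrainTopEig v y ^ (q - 2) * (torusStrainTopEig v y * topProj v y i j)) := by
  unfold Torus.IsSmooth
  rw [← liftAt_zero_left]
  refine contDiff_iff_contDiffAt.2 fun w => ?_
  have hx := hsimple ((0 : UnitAddTorus (Fin 3)) + proj w)
  have hh : ContDiffAt ℝ ∞
      (liftAt (fun z => torusStrainTopEig v z * topProj v z i j) ((0 : UnitAddTorus (Fin 3)) + proj w)) 0 :=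
    (contDiffAt_liftAt_torusStrainTopEig_of_midEig_lt hv hx).mul (contDiffAt_liftAt_topProj_of_simple hv hx i j)
  exact contDiffAt_liftAt_of_shift (contDiffAt_liftAt_rpow_topEig_mul hv hdiv q hx hh)

/-- `M_q` is symmetric. [ours, bookkeeping] -/
theorem powProj_symm (q : ℝ) (v : UnitAddTorus (Fin 3) → EuclideanSpace ℝ (Fin 3)) (i j : Fin 3)
    (x : UnitAddTorus (Fin 3)) :
    torusStrainTopEig v x ^ (q - 2) * (torusStrainTopEig v x * topProj v x i j) =
      torusStrainTopEig v x ^ (q - 2) * (torusStrainTopEig v x * topProj v x j i) := by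
  simp only [topProj, Matrix.vecMulVec_apply, mul_comm (topVec v x i)]

/-- **`∑ᵢⱼ Sᵢⱼ (M_q)ᵢⱼ = λ₁^q`** at every point with `λ₁ > 0` (`∑ Sᵢⱼ(λ₁P₁)ᵢⱼ = λ₁²`, tree). [ours, bookkeeping] -/
theorem sum_strain_mul_powProj {q : ℝ} {x : UnitAddTorus (Fin 3)} (hpos : 0 < torusStrainTopEig v x) :
    ∑ i, ∑ j, torusStrainMatrix v x i j *
        (torusStrainTopEig v x ^ (q - 2) * (torusStrainTopEig v x * topProj v x i j)) =
      torusStrainTopEig v x ^ q := by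
  have h := sum_strain_mul_lamProj v x
  have e : ∀ i j, torusStrainMatrix v x i j *
      (torusStrainTopEig v x ^ (q - 2) * (torusStrainTopEig v x * topProj v x i j)) =
      torusStrainTopEig v x ^ (q - 2) * (torusStrainMatrix v x i j * (torusStrainTopEig v x * topProj v x i j)) :=
    fun i j => by ring
  simp_rw [e, ← Finset.mul_sum]
  rw [h, show q = (q - 2) + 2 by ring, Real.rpow_add hpos, show (q - 2 + 2 - 2) = q - 2 by ring,
    Real.rpow_two]

/-! ## 2. Pointwise: the gradient of `M_q` against the `e₁`-column of `∇S` -/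

/-- **On the top-gap class, `∑ᵢⱼ (∂ₖ(M_q)ᵢⱼ)² ≤ 2((q−2)² + 2/η²)·(λ₁^{q−2})²·|S(∂ₖv)u₀|²` at every simple
point** (every real `q`): product rule `∂ₖ(λ₁^{q−2}·(λ₁P)) = (q−2)λ₁^{q−3}(∂ₖλ₁)·λ₁P + λ₁^{q−2}∂ₖ(λ₁P)`,
`|P| = 1`, Hellmann–Feynman `(∂ₖλ₁)² = (u₀ᵀS(∂ₖv)u₀)² ≤ |S(∂ₖv)u₀|²`, and the tree bound
`∑(∂ₖ(λ₁P))² ≤ (2/η²)|S(∂ₖv)u₀|²`. [ours] -/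
theorem sum_sq_partialDeriv_powProj_le_of_gap (hv : Torus.IsSmooth v) (hdiv : Torus.IsDivFree v) (q : ℝ)
    {η : ℝ} (hη0 : 0 < η) (hη1 : η ≤ 1)
    {x : UnitAddTorus (Fin 3)} (hx : torusStrainMidEig v x < torusStrainTopEig v x)
    (hgapx : torusStrainMidEig v x ≤ (1 - η) * torusStrainTopEig v x) (k : Fin 3) :
    ∑ i, ∑ j, (Torus.partialDeriv k
        (fun y => torusStrainTopEig v y ^ (q - 2) * (torusStrainTopEig v y * topProj v y i j)) x) ^ 2 ≤
      2 * ((q - 2) ^ 2 + 2 / η ^ 2) * (torusStrainTopEig v x ^ (q - 2)) ^ 2 *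
        ((torusStrainMatrix (Torus.partialDeriv k v) x *ᵥ topVec v x) ⬝ᵥ
          (torusStrainMatrix (Torus.partialDeriv k v) x *ᵥ topVec v x)) := by
  have ha₀ := eigenvalues_topIndex v x
  set e : Fin 3 → ℝ := topVec v x with hedef
  set M : Matrix (Fin 3) (Fin 3) ℝ := torusStrainMatrix (Torus.partialDeriv k v) x with hMdef
  set lam : ℝ := torusStrainTopEig v x with hlam
  have hlam0 : 0 < lam := topEig_pos_of_simple hv hdiv hx
  have he1 : e ⬝ᵥ e = 1 := topVec_dotProduct_self v x
  set a : ℝ := e ⬝ᵥ (M *ᵥ e) with hadef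
  -- derivatives along the coordinate line through `x`
  have hHF1 : HasDerivAt (fun t : ℝ => torusStrainTopEig v (x + proj (t • EuclideanSpace.single k (1 : ℝ)))) a 0 :=
    hasDerivAt_topEig_coordLine hv hx ha₀ k
  obtain ⟨N', hder, -, -⟩ := hasDerivAt_topProj_coordLine hv hx ha₀ k
  have hlam0' : torusStrainTopEig v (x + proj ((0 : ℝ) • EuclideanSpace.single k (1 : ℝ))) = lam := by
    rw [coordLine_zero]
  have hP0 : ∀ i j, topProj v (x + proj ((0 : ℝ) • EuclideanSpace.single k (1 : ℝ))) i j = e i * e j := by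
    intro i j; rw [coordLine_zero]; rfl
  -- the power factor
  have hw : HasDerivAt (fun t : ℝ => torusStrainTopEig v (x + proj (t • EuclideanSpace.single k (1 : ℝ))) ^ (q - 2))
      (a * (q - 2) * lam ^ (q - 2 - 1)) 0 := by
    have h := hHF1.rpow_const (p := q - 2) (Or.inl (by rw [hlam0']; exact hlam0.ne'))
    rw [hlam0'] at h
    exact h
  -- the entries of `λ₁P` and their `∂ₖ`
  set d : Fin 3 → Fin 3 → ℝ := fun i j =>
    Torus.partialDeriv k (fun y => torusStrainTopEig v y * topProj v y i j) x with hddef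
  have hg : ∀ i j, HasDerivAt (fun t : ℝ => torusStrainTopEig v (x + proj (t • EuclideanSpace.single k (1 : ℝ))) *
      topProj v (x + proj (t • EuclideanSpace.single k (1 : ℝ))) i j) (d i j) 0 := by
    intro i j
    have h := hHF1.mul (hder i j)
    have hd : d i j = a * topProj v (x + proj ((0 : ℝ) • EuclideanSpace.single k (1 : ℝ))) i j +
        torusStrainTopEig v (x + proj ((0 : ℝ) • EuclideanSpace.single k (1 : ℝ))) * (N' i * e j + e i * N' j) :=
      h.deriv
    rw [hd]
    exact h
  -- `∂ₖ (M_q)ᵢⱼ = (a (q−2) λ^{q−3})·(λ eᵢeⱼ) + λ^{q−2} dᵢⱼ`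
  have hpd : ∀ i j, Torus.partialDeriv k
      (fun y => torusStrainTopEig v y ^ (q - 2) * (torusStrainTopEig v y * topProj v y i j)) x =
      a * (q - 2) * lam ^ (q - 2 - 1) * (lam * (e i * e j)) + lam ^ (q - 2) * d i j := by
    intro i j
    have h := hw.mul (hg i j)
    rw [hlam0', hP0 i j] at h
    exact h.deriv
  simp_rw [hpd]
  -- the tree bound on `∑ dᵢⱼ²`
  have hD : ∑ i, ∑ j, d i j ^ 2 ≤ 2 / η ^ 2 * ((M *ᵥ e) ⬝ᵥ (M *ᵥ e)) :=
    sum_sq_partialDeriv_lamProj_le_of_gap hv hdiv hη0 hη1 hx hgapx ha₀ k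
  -- `a² ≤ |Me|²`
  have ha2 : a ^ 2 ≤ (M *ᵥ e) ⬝ᵥ (M *ᵥ e) := by
    rw [← sum_sq_frame_eq_column_sq x M e]
    have : a = ((torusStrainMatrix_isHermitian v x).eigenvectorBasis (topIndex v x)).ofLp ⬝ᵥ (M *ᵥ e) := rfl
    rw [this]
    exact Finset.single_le_sum (f := fun b => (((torusStrainMatrix_isHermitian v x).eigenvectorBasis b).ofLp ⬝ᵥ
      (M *ᵥ e)) ^ 2) (fun _ _ => sq_nonneg _) (Finset.mem_univ _)
  -- algebra: `λ^{q−3}·λ = λ^{q−2}`, `∑(eᵢeⱼ)² = 1`, `(α+β)² ≤ 2α² + 2β²`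
  have e3 : lam ^ (q - 2 - 1) * lam = lam ^ (q - 2) := by
    rw [Real.rpow_sub_one hlam0.ne']; field_simp
  have hterm : ∀ i j, a * (q - 2) * lam ^ (q - 2 - 1) * (lam * (e i * e j)) + lam ^ (q - 2) * d i j =
      lam ^ (q - 2) * ((q - 2) * a * (e i * e j) + d i j) := by
    intro i j
    have : a * (q - 2) * lam ^ (q - 2 - 1) * (lam * (e i * e j)) =
        lam ^ (q - 2) * ((q - 2) * a * (e i * e j)) := by
      rw [← e3]; ring
    rw [this]; ring
  simp_rw [hterm, mul_pow, ← Finset.mul_sum]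
  have hsum1 : ∑ i, ∑ j, (e i * e j) ^ 2 = 1 := by
    have h1 : ∑ i, e i * e i = 1 := by simpa [dotProduct] using he1
    have : ∑ i, ∑ j, (e i * e j) ^ 2 = (∑ i, e i * e i) * (∑ j, e j * e j) := by
      rw [Finset.sum_mul_sum]
      exact Finset.sum_congr rfl fun i _ => Finset.sum_congr rfl fun j _ => by ring
    rw [this, h1, mul_one]
  have hsq : ∑ i, ∑ j, ((q - 2) * a * (e i * e j) + d i j) ^ 2 ≤
      2 * ((q - 2) ^ 2 * a ^ 2) + 2 * ∑ i, ∑ j, d i j ^ 2 := by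
    have hle : ∀ i j, ((q - 2) * a * (e i * e j) + d i j) ^ 2 ≤
        2 * (((q - 2) * a) ^ 2 * (e i * e j) ^ 2) + 2 * d i j ^ 2 := fun i j => by
      nlinarith [sq_nonneg ((q - 2) * a * (e i * e j) - d i j)]
    have hX : ((q - 2) * a) ^ 2 * (∑ i, ∑ j, (e i * e j) ^ 2) = (q - 2) ^ 2 * a ^ 2 := by
      rw [hsum1]; ring
    simp only [Fin.sum_univ_three] at hX ⊢
    linarith [hle 0 0, hle 0 1, hle 0 2, hle 1 0, hle 1 1, hle 1 2, hle 2 0, hle 2 1, hle 2 2]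
  have hpow0 : 0 ≤ (lam ^ (q - 2)) ^ 2 := sq_nonneg _
  have hMe0 : 0 ≤ (M *ᵥ e) ⬝ᵥ (M *ᵥ e) := by
    rw [← sum_sq_frame_eq_column_sq (v := v) x M e]; exact Finset.sum_nonneg fun _ _ => sq_nonneg _
  have hη2 : 0 < η ^ 2 := by positivity
  calc (lam ^ (q - 2)) ^ 2 * ∑ i, ∑ j, ((q - 2) * a * (e i * e j) + d i j) ^ 2
      ≤ (lam ^ (q - 2)) ^ 2 * (2 * ((q - 2) ^ 2 * a ^ 2) + 2 * ∑ i, ∑ j, d i j ^ 2) :=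
        mul_le_mul_of_nonneg_left hsq hpow0
    _ ≤ (lam ^ (q - 2)) ^ 2 * (2 * ((q - 2) ^ 2 * ((M *ᵥ e) ⬝ᵥ (M *ᵥ e))) +
          2 * (2 / η ^ 2 * ((M *ᵥ e) ⬝ᵥ (M *ᵥ e)))) := by
        gcongr
    _ = 2 * ((q - 2) ^ 2 + 2 / η ^ 2) * (lam ^ (q - 2)) ^ 2 * ((M *ᵥ e) ⬝ᵥ (M *ᵥ e)) := by ring

/-- Summed over the three directions: `∑ₖ∑ᵢⱼ(∂ₖ(M_q)ᵢⱼ)² ≤ 2((q−2)² + 2/η²)·(λ₁^{q−2})²·topColumnSq`.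
[ours, bookkeeping] -/
theorem sum_sq_partialDeriv_powProj_le_topColumnSq (hv : Torus.IsSmooth v) (hdiv : Torus.IsDivFree v) (q : ℝ)
    {η : ℝ} (hη0 : 0 < η) (hη1 : η ≤ 1)
    {x : UnitAddTorus (Fin 3)} (hx : torusStrainMidEig v x < torusStrainTopEig v x)
    (hgapx : torusStrainMidEig v x ≤ (1 - η) * torusStrainTopEig v x) :
    ∑ k, ∑ i, ∑ j, (Torus.partialDeriv k
        (fun y => torusStrainTopEig v y ^ (q - 2) * (torusStrainTopEig v y * topProj v y i j)) x) ^ 2 ≤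
      2 * ((q - 2) ^ 2 + 2 / η ^ 2) * (torusStrainTopEig v x ^ (q - 2)) ^ 2 * topColumnSq v x := by
  unfold topColumnSq
  rw [Finset.mul_sum]
  exact Finset.sum_le_sum fun k _ => sum_sq_partialDeriv_powProj_le_of_gap hv hdiv q hη0 hη1 hx hgapx k

/-! ## 3. Continuity of the column density `topColumnSq` on everywhere-simple fields -/

/-- The entries of the strain matrix of a smooth field are continuous. [ours, bookkeeping] -/
theorem continuous_torusStrainMatrix_entry {w : UnitAddTorus (Fin 3) → EuclideanSpace ℝ (Fin 3)}
    (hw : Torus.IsSmooth w) (i j : Fin 3) : Continuous fun x => torusStrainMatrix w x i j := by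
  have hc : ∀ a b : Fin 3, Continuous fun x => Torus.partialDeriv a w x b := fun a b =>
    (EuclideanSpace.proj b).continuous.comp (hw.partialDeriv a).continuous
  have e : (fun x => torusStrainMatrix w x i j) =
      fun x => (Torus.partialDeriv j w x i + Torus.partialDeriv i w x j) / 2 := by
    funext x; simp [torusStrainMatrix, Matrix.of_apply]
  rw [e]
  exact ((hc j i).add (hc i j)).div_const 2

/-- `|S(∂ₖv)u₀|²` through the projector: `(Me)·(Me) = ∑_{bc} (M·M)_{bc} (P₁)_{cb}` for the symmetric
`M = S(∂ₖv)(x)`. [ours, bookkeeping] -/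
theorem column_sq_eq_sum_topProj (v : UnitAddTorus (Fin 3) → EuclideanSpace ℝ (Fin 3)) (x : UnitAddTorus (Fin 3))
    (k : Fin 3) :
    (torusStrainMatrix (Torus.partialDeriv k v) x *ᵥ topVec v x) ⬝ᵥ
        (torusStrainMatrix (Torus.partialDeriv k v) x *ᵥ topVec v x) =
      ∑ b, ∑ c, (∑ a, torusStrainMatrix (Torus.partialDeriv k v) x b a *
        torusStrainMatrix (Torus.partialDeriv k v) x a c) * topProj v x c b := by
  have hsymm : (torusStrainMatrix (Torus.partialDeriv k v) x)ᵀ = torusStrainMatrix (Torus.partialDeriv k v) x :=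
    (torusStrainMatrix_isSymm (Torus.partialDeriv k v) x).eq
  rw [Matrix.dotProduct_mulVec, ← Matrix.mulVec_transpose, Matrix.mulVec_mulVec, hsymm]
  simp only [dotProduct, Matrix.mulVec, Matrix.mul_apply, topProj, Matrix.vecMulVec_apply, Finset.sum_mul]
  exact Finset.sum_congr rfl fun b _ => Finset.sum_congr rfl fun c _ =>
    Finset.sum_congr rfl fun a _ => by ring

/-- On everywhere-simple fields, `topColumnSq v` is continuous (the projector `P₁` is smooth there).
[ours, bookkeeping] -/
theorem continuous_topColumnSq (hv : Torus.IsSmooth v)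
    (hsimple : ∀ x : UnitAddTorus (Fin 3), torusStrainMidEig v x < torusStrainTopEig v x) :
    Continuous (topColumnSq v) := by
  have e : topColumnSq v = fun x => ∑ k, ∑ b, ∑ c, (∑ a, torusStrainMatrix (Torus.partialDeriv k v) x b a *
      torusStrainMatrix (Torus.partialDeriv k v) x a c) * topProj v x c b := by
    funext x
    unfold topColumnSq
    exact Finset.sum_congr rfl fun k _ => column_sq_eq_sum_topProj v x k
  rw [e]
  refine continuous_finsetSum _ fun k _ => continuous_finsetSum _ fun b _ =>
    continuous_finsetSum _ fun c _ => ?_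
  refine (continuous_finsetSum _ fun a _ => ?_).mul (isSmooth_topProj_entry hv hsimple c b).continuous
  exact (continuous_torusStrainMatrix_entry (hv.partialDeriv k) b a).mul
    (continuous_torusStrainMatrix_entry (hv.partialDeriv k) a c)

/-! ## 4. The velocity brick on the amplitude-floor class, `6/5 ≤ q ≤ 2` -/

/-- **THE SOBOLEV–HÖLDER BRICK ON THE FLOOR CLASS.** For `6/5 ≤ q ≤ 2` there is `K₀ ≥ 0` (the square of
`6 ·` Sobolev–Poincaré constant at `(s, r) = (q, 2)` `·` Calderón–Zygmund constant at `q`) such that for every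
smooth, divergence-free, zero-mean `u` on `T³` and every `m > 0` with `λ₁ ≥ m` everywhere:
`∫ ‖u‖² λ₁^{q−2} ≤ K₀ · m^{q−2} · Φ_q(u)^{2/q}` (`λ₁^{q−2} ≤ m^{q−2}`, `‖u‖₂ ≤ C‖∇u‖_q ≤ CK‖S‖_q ≤ 6CK‖λ₁‖_q`).
[ours] -/
theorem exists_integral_norm_sq_mul_topEig_rpow_le_of_floor {q : ℝ} (hq : 6 / 5 ≤ q) (hq2 : q ≤ 2) :
    ∃ K₀ : ℝ, 0 ≤ K₀ ∧ ∀ (u : UnitAddTorus (Fin 3) → EuclideanSpace ℝ (Fin 3)), Torus.IsSmooth u →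
      Torus.IsDivFree u → Torus.HasZeroMean u → ∀ m : ℝ, 0 < m →
      (∀ x, m ≤ torusStrainTopEig u x) →
        ∫ x, ‖u x‖ ^ 2 * torusStrainTopEig u x ^ (q - 2) ≤ K₀ * m ^ (q - 2) * torusTopEigMoment q u ^ (2 / q) := by
  have hq0 : 0 < q := by linarith
  have hq1 : 1 < q := by linarith
  have hq3 : q < 3 := by linarith
  have hsr : 1 / q - 1 / 3 ≤ 1 / (2 : ℝ) := by
    rw [div_sub_div _ _ hq0.ne' (by norm_num), div_le_div_iff₀ (by positivity) (by norm_num)]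
    nlinarith
  obtain ⟨C, hC0, hC⟩ := Torus.exists_integral_rpow_le_gradient_of_hasZeroMean (d := Fin 3)
    (F' := EuclideanSpace ℝ (Fin 3)) (by simp) hq1.le hq3 (by norm_num : (0 : ℝ) < 2) hsr
  obtain ⟨K, hK0, hK⟩ := StrainTensor.exists_gradLs_le_strainLs hq1
  refine ⟨(6 * C * K) ^ 2, by positivity, fun u hu hdiv hmean m hm hfloor => ?_⟩
  have hl0 : ∀ x, 0 ≤ torusStrainTopEig u x := fun x => hm.le.trans (hfloor x)
  have huc : Continuous u := hu.continuous
  have hlc : Continuous (torusStrainTopEig u) := continuous_torusStrainTopEig hu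
  have hF0 : 0 ≤ torusTopEigMoment q u := torusTopEigMoment_nonneg q u
  -- (a) `λ₁^{q−2} ≤ m^{q−2}` pointwise, hence `∫‖u‖²λ₁^{q−2} ≤ m^{q−2} ∫‖u‖²`
  have hpt : ∀ x, ‖u x‖ ^ 2 * torusStrainTopEig u x ^ (q - 2) ≤ m ^ (q - 2) * ‖u x‖ ^ 2 := by
    intro x
    rw [mul_comm]
    exact mul_le_mul_of_nonneg_right
      (Real.rpow_le_rpow_of_nonpos hm (hfloor x) (by linarith)) (sq_nonneg _)
  have hLc : Continuous fun x => torusStrainTopEig u x ^ (q - 2) :=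
    hlc.rpow_const fun x => Or.inl (hm.trans_le (hfloor x)).ne'
  have h1 : ∫ x, ‖u x‖ ^ 2 * torusStrainTopEig u x ^ (q - 2) ≤ m ^ (q - 2) * ∫ x, ‖u x‖ ^ 2 := by
    rw [← integral_const_mul]
    exact integral_mono ((huc.norm.pow 2).mul hLc).integrable_unitAddTorus
      ((huc.norm.pow 2).const_mul _).integrable_unitAddTorus hpt
  -- (b) `(∫‖u‖²)^{1/2} ≤ 6CK Φ_q^{1/q}`
  have hS : (∫ x, Real.sqrt (torusStrainSqAt u x) ^ q) ^ (1 / q) ≤ 6 * torusTopEigMoment q u ^ (1 / q) := by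
    have hp : ∀ x, Real.sqrt (torusStrainSqAt u x) ^ q ≤ (6 : ℝ) ^ q * torusStrainTopEig u x ^ q := by
      intro x
      rw [← norm_strainFlat_eq_sqrt, ← Real.mul_rpow (by norm_num) (hl0 x), ← lam_strainFlat]
      exact Real.rpow_le_rpow (norm_nonneg _) (norm_strainFlat_le hu hdiv x) hq0.le
    have hqc : Continuous fun x => torusStrainTopEig u x ^ q := hlc.rpow_const fun x => Or.inr hq0.le
    have hint : ∫ x, Real.sqrt (torusStrainSqAt u x) ^ q ≤ (6 : ℝ) ^ q * ∫ x, torusStrainTopEig u x ^ q := by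
      rw [← integral_const_mul]
      exact integral_mono_of_nonneg (ae_of_all _ fun x => Real.rpow_nonneg (Real.sqrt_nonneg _) _)
        ((hqc.const_mul _).integrable_unitAddTorus) (ae_of_all _ hp)
    have hI0 : 0 ≤ ∫ x, Real.sqrt (torusStrainSqAt u x) ^ q :=
      integral_nonneg fun x => Real.rpow_nonneg (Real.sqrt_nonneg _) _
    have hJ : ∫ x, torusStrainTopEig u x ^ q = torusTopEigMoment q u := by
      rw [torusTopEigMoment_eq hu hdiv q]
      exact integral_congr_ae (ae_of_all _ fun x => by show _ = lam _ ^ q; rw [lam_strainFlat])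
    calc (∫ x, Real.sqrt (torusStrainSqAt u x) ^ q) ^ (1 / q)
        ≤ ((6 : ℝ) ^ q * ∫ x, torusStrainTopEig u x ^ q) ^ (1 / q) := Real.rpow_le_rpow hI0 hint (by positivity)
      _ = 6 * torusTopEigMoment q u ^ (1 / q) := by
          rw [hJ, Real.mul_rpow (by positivity) hF0, ← Real.rpow_mul (by norm_num : (0 : ℝ) ≤ 6),
            show q * (1 / q) = 1 by field_simp, Real.rpow_one]
  have hV : (∫ x, ‖u x‖ ^ (2 : ℝ)) ^ (1 / (2 : ℝ)) ≤ 6 * C * K * torusTopEigMoment q u ^ (1 / q) := by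
    have ha := hC u hu hmean
    have hb := hK u hu hdiv
    have hG0 : 0 ≤ (∫ x, Real.sqrt (∑ j, ‖Torus.partialDeriv j u x‖ ^ 2) ^ q) ^ (1 / q) :=
      Real.rpow_nonneg (integral_nonneg fun x => Real.rpow_nonneg (Real.sqrt_nonneg _) _) _
    calc (∫ x, ‖u x‖ ^ (2 : ℝ)) ^ (1 / (2 : ℝ))
        ≤ C * (∫ x, Real.sqrt (∑ j, ‖Torus.partialDeriv j u x‖ ^ 2) ^ q) ^ (1 / q) := ha
      _ ≤ C * (K * (6 * torusTopEigMoment q u ^ (1 / q))) := by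
          refine mul_le_mul_of_nonneg_left (hb.trans ?_) hC0
          exact mul_le_mul_of_nonneg_left hS hK0
      _ = 6 * C * K * torusTopEigMoment q u ^ (1 / q) := by ring
  have hI2 : 0 ≤ ∫ x, ‖u x‖ ^ (2 : ℝ) := integral_nonneg fun x => Real.rpow_nonneg (norm_nonneg _) _
  have h2 : ∫ x, ‖u x‖ ^ 2 ≤ (6 * C * K) ^ 2 * torusTopEigMoment q u ^ (2 / q) := by
    have e1 : ∫ x, ‖u x‖ ^ 2 = ((∫ x, ‖u x‖ ^ (2 : ℝ)) ^ (1 / (2 : ℝ))) ^ 2 := by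
      rw [← Real.rpow_natCast, ← Real.rpow_mul hI2]
      norm_num
    have e2 : torusTopEigMoment q u ^ (2 / q) = (torusTopEigMoment q u ^ (1 / q)) ^ 2 := by
      rw [← Real.rpow_natCast, ← Real.rpow_mul hF0]; congr 1; push_cast; ring
    rw [e1, e2, ← mul_pow]
    exact pow_le_pow_left₀ (Real.rpow_nonneg hI2 _) hV 2
  have hm0 : 0 ≤ m ^ (q - 2) := Real.rpow_nonneg hm.le _
  calc ∫ x, ‖u x‖ ^ 2 * torusStrainTopEig u x ^ (q - 2) ≤ m ^ (q - 2) * ∫ x, ‖u x‖ ^ 2 := h1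
    _ ≤ m ^ (q - 2) * ((6 * C * K) ^ 2 * torusTopEigMoment q u ^ (2 / q)) := mul_le_mul_of_nonneg_left h2 hm0
    _ = (6 * C * K) ^ 2 * m ^ (q - 2) * torusTopEigMoment q u ^ (2 / q) := by ring

end TopEig

end Summit.NavierStokesRegularity.FunctionalMining

end
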